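import Literature.AlgebraicGeometry.Motives.AbelianVarietyTranslationAction
import Literature.AlgebraicGeometry.Motives.AbelianVarietyTranslationFree
import Literature.AlgebraicGeometry.Motives.AbelianVarietyFrobeniusCharpolyRigidity
import Literature.AlgebraicGeometry.Motives.AlgPointsMapSurjectiveAlgClosed
import Literature.AlgebraicGeometry.RelativeSpec.GeometricQuotientOfEtaleCover
import Mathlib.AlgebraicGeometry.Morphisms.Flat
import HarnessLib

/-!
# An étale isogeny over a separably closed field is a free affine geometric quotient by its kernel translations
# ([MumfordAV1970] §7 Thm. 4, [SGA1] V Prop. 2.6) — characteristic-free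

Layer `Literature/AlgebraicGeometry/Motives`, namespace `Literature.AlgebraicGeometry.Motives.AbelianVariety`.
THEOREMS ONLY (no definition, no named fact, no instance, no notation, no `sorry`).

The tree's ★ `AbelianVarietyIsogenyGeometricQuotient` proves, for an isogeny `f : A → B` of COMPLEX abelian varieties,
that `f` is an affine geometric quotient of `A` by the translation action of `Ker f(ℂ)` (★ `kerTranslationActionOver`,
`isGeometricQuotient_kerTranslationActionOver`), through the recognition theorem ★
`FiniteQuotientRecognition.isSepQuotient_of_isProper_of_bijective` («proper + bijective on `ℂ`-points onto a smooth
variety ⇒ isomorphism»), which is characteristic `0` in substance (Frobenius is a counterexample in characteristic `p`;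
and `#ker F̂ = p > 1 = #ker F(Ω)` for an ordinary elliptic curve shows the downstream count fails for inseparable
isogenies).  This file gives the CHARACTERISTIC-FREE statement for ÉTALE isogenies over a separably closed field `K`
(e.g. `K = κ̄(w)`), by the converse direction of [SGA1] V Prop. 2.6 (★
`RelativeSpec.GeometricQuotientOfEtaleCover.isGeometricQuotient_of_etale_of_transitive`: an affine étale surjective
`G`-morphism transitive on ALL geometric fibres is a geometric quotient — no bijectivity recognition):

* §1 (any field) `kerTranslationActionOver_free'` — the ★ complex lemma re-run verbatim over any field (an isogeny is
  finite hence affine, ★ `isAffineHom_of_isIsogeny`; a non-trivial translation moves every affine chart, ★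
  `span_range_translation_appLE_sub_eq_top`);
* §2 (any field) `comp_translation_point` — on `L`-valued points `Q ≫ t_P = P_L · Q` (`P_L` the scalar extension
  `Spec L → Spec K → A` of the rational point `P`);
* §3 `kerPointsComap_toSpecOver_injective` / **`kerPointsComap_toSpecOver_bijective`** — «KERNEL POINTS OF AN ÉTALE
  ISOGENY DO NOT GROW»: for `K ⊆ L` both separably closed and `f` finite étale, restriction `Ker f(K) → Ker f(L)` is a
  bijection (★ `Hom.kerPointsComap`; injective because `Spec L → Spec K` is an epimorphism; both sides have
  `kerRank f` elements, ★ `natCard_kerPoints_eq_kerRank`, [GortzWedhorn2023] Prop. 27.188 (1));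
* §4 **`kerTranslationActionOver_transitive`** — hence two `Ω`-valued points (`Ω` ANY algebraically closed field) of
  `A` with the same image under `f` differ by the translation by a `K`-RATIONAL kernel point;
* §5 **`isGeometricQuotient_kerTranslationActionOver_of_etale`** — THE HEAD: for `K` separably closed and `f` an étale
  isogeny, `(kerTranslationActionOver f).IsGeometricQuotient (Hom.toSchemeHom f)`;
* §6 `natCard_kerPoints_comp_of_isAlgClosed`, `IsIsogeny.natCard_kerPoints_comp_of_isAlgClosed` —
  `#Ker (f ≫ g)(K) = #Ker f(K) · #Ker g(K)` for `f` surjective and `K` algebraically closed (the ★ complex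
  `natCard_kerPoints_comp`, [Lange2023AbelianVarietiesComplex] Prop. 1.1.13 (b), with ★
  `AlgPoints.map_surjective_of_surjective_of_isAlgClosed'` in place of the complex lifting).

Written for cell `hodgecm-mathlib` (D-0151), crux hLiu418 line L3 (`stub_FROB` → `stub_ROOF0`, RULING «DUAL-B̄» #3 organ
H5: the `hStab`/count package of ★ `PoincarePullbackStabilizerOfLevel` at a geometric point `Spec κ̄(w)`); consumed by
`AbelianSchemes/PoincarePullbackKernelCountGeometric`.  Count-neutral.  HC_CM is proved only modulo the 7 printed
citations until rung 0 closes; nothing here is about HC.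

## References
* [MumfordAV1970] D. Mumford, *Abelian Varieties* (1970), §7 Thm. p. 66 and Thm. 4 (p. 72); §6 Application 3 (p. 64).
* [SGA1] A. Grothendieck, *SGA 1*, Exp. V, Prop. 2.6, Déf. 2.7.
* [GortzWedhorn2023] U. Görtz, T. Wedhorn, *Algebraic Geometry II* (2023), Def./Rem. 27.1 (p. 799), Prop. 27.187,
  Prop. 27.188 (1).
* [Lange2023AbelianVarietiesComplex] H. Lange, *Abelian Varieties over the Complex Numbers* (2023), §1.1.2 Prop. 1.1.13 (b)
  (PDF p. 22).
* [Hartshorne1977] R. Hartshorne, *Algebraic Geometry* (1977), II Ex. 2.7 (points with values in a field).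
-/

noncomputable section

universe u

open CategoryTheory CategoryTheory.Limits AlgebraicGeometry MonoidalCategory
open Literature.AlgebraicGeometry.RelativeSpec

namespace Literature.AlgebraicGeometry.Motives

namespace AbelianVariety

open scoped MonObj Obj

/-! ## §1 Any field: an isogeny is affine; the kernel translations act freely on the charts `f⁻¹V` -/

section AnyField

variable {K : Type u} [Field K] {A B : AbelianVariety K} (f : A ⟶ B)

/-- **The kernel translations act freely on the affine charts `f⁻¹V`** (the Chase–Harrison–Rosenberg hypothesis
`hfree` of the descent theorems) — ★ `kerTranslationActionOver_free` over any field: for `V ⊆ B` affine and `x ≠ 1`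
the elements `x · b - b`, `b ∈ Γ(A, f⁻¹V)`, generate the unit ideal (★ `span_range_translation_appLE_sub_eq_top`).
[cite: MumfordAV1970, §7 Thm. 4 (p. 72)] -/
theorem kerTranslationActionOver_free' (hf : IsIsogeny f) (V : B.X.left.Opens) (hV : IsAffineOpen V)
    (x : Hom.kerPoints (specOver K K) f) (hx : x ≠ 1) :
    Ideal.span (Set.range fun b : Γ(A.X.left, Hom.toSchemeHom f ⁻¹ᵁ V) ↦
      (kerTranslationActionOver f).act x V b - b) = ⊤ := by
  haveI : IsFinite (Hom.toSchemeHom f) := hf.2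
  have hx' : ((x : A.Points K))⁻¹ ≠ 1 := by
    rw [Ne, inv_eq_one]
    exact fun h => hx (Subtype.ext h)
  exact A.span_range_translation_appLE_sub_eq_top (hV.preimage _) ((x : A.Points K)⁻¹) hx' _

/-! ## §2 Translations on points with values in a field extension -/

/-- Every morphism `X ⟶ Spec K` over `Spec K` is THE structure morphism `toSpecOver X`.
[cite: Hartshorne1977, II Ex. 2.7] -/
private theorem eq_toSpecOver₃ {X : SchemeOver K} (g : X ⟶ specOver K K) : g = toSpecOver X := by
  ext : 1
  haveI : IsIso (specOver K K).hom := by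
    change IsIso (Spec.map (CommRingCat.ofHom (algebraMap K K)))
    rw [Algebra.algebraMap_self, CommRingCat.ofHom_id, Spec.map_id]
    infer_instance
  rw [← cancel_mono (specOver K K).hom, Over.w g, Over.w (toSpecOver X)]

/-- **On `L`-valued points, `t_P` is left multiplication by the scalar extension of `P`**: for a rational point
`P ∈ A(K)` and an `L`-valued point `Q` (`L ⊇ K` any field), `Q ≫ t_P = P_L · Q` with
`P_L := (Spec L → Spec K) ≫ P` (★ `comp_translation` is the case `L = K`).
[cite: GortzWedhorn2023, Def./Rem. 27.1 (p. 799)] -/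
theorem comp_translation_point {L : Type u} [Field L] [Algebra K L] (Q : A.Points L) (P : A.Points K) :
    Q ≫ A.translation P = (toSpecOver (specOver K L) ≫ P) * Q := by
  change Q ≫ ((toSpecOver A.X ≫ P) * 𝟙 A.X) = _
  rw [MonObj.comp_mul, Category.comp_id, ← Category.assoc, eq_toSpecOver₃ (Q ≫ toSpecOver A.X)]

/-! ## §3 Kernel points of an étale isogeny do not grow under separably closed field extensions -/

variable (L : Type u) [Field L] [Algebra K L]

/-- `Spec L → Spec K` is an epimorphism of schemes (flat and surjective onto a point).
[cite: Hartshorne1977, II Ex. 2.7] -/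
private theorem epi_toSpecOver_specOver_left : Epi (toSpecOver (specOver K L)).left := by
  rw [toSpecOver_left]
  change Epi (Spec.map (CommRingCat.ofHom (algebraMap K L)))
  haveI : Flat (Spec.map (CommRingCat.ofHom (algebraMap K L))) :=
    HasRingHomProperty.Spec_iff.mpr (RingHom.Flat.of_isField (Field.toIsField K) _)
  haveI : Surjective (Spec.map (CommRingCat.ofHom (algebraMap K L))) :=
    ⟨fun x ↦ ⟨default, Subsingleton.elim _ _⟩⟩
  exact Flat.epi_of_flat_of_surjective _

/-- **Restriction of kernel points `Ker f(K) → Ker f(L)` along a field extension is injective** (★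
`Hom.kerPointsComap` along `Spec L → Spec K`, an epimorphism). [cite: Hartshorne1977, II Ex. 2.7]
[cite: GortzWedhorn2023, (27.1.1) (p. 800)] -/
theorem kerPointsComap_toSpecOver_injective :
    Function.Injective (Hom.kerPointsComap f (toSpecOver (specOver K L))) := by
  intro x y h
  apply Subtype.ext
  have h' := congrArg (fun z => ((z : Hom.kerPoints (specOver K L) f) : A.Points L)) h
  simp only [Hom.coe_kerPointsComap] at h'
  have h'' := congrArg CommaMorphism.left h'
  simp only [Over.comp_left] at h''
  haveI := epi_toSpecOver_specOver_left (K := K) L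
  ext : 1
  exact (cancel_epi (toSpecOver (specOver K L)).left).mp h''

/-- **Kernel points of a finite étale homomorphism do not grow: `Ker f(K) → Ker f(L)` is a BIJECTION for `K ⊆ L`
both separably closed** — it is injective and both sides have `kerRank f = dim_K Γ(Ker f, 𝒪)` elements (★
`natCard_kerPoints_eq_kerRank` at `L := K` and at `L`; [GortzWedhorn2023] Prop. 27.188 (1)).
[cite: GortzWedhorn2023, Prop. 27.188 (1)] [cite: MumfordAV1970, §6 Application 3 (Proposition p. 64)] -/
theorem kerPointsComap_toSpecOver_bijective [IsSepClosed K] [IsSepClosed L] [IsFinite (Hom.toSchemeHom f)]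
    [Etale (Hom.toSchemeHom f)] :
    Function.Bijective (Hom.kerPointsComap f (toSpecOver (specOver K L))) := by
  haveI : Finite (Hom.kerPoints (specOver K L) f) := finite_kerPoints_of_isFinite f L
  refine (kerPointsComap_toSpecOver_injective f L).bijective_of_nat_card_le (le_of_eq ?_)
  rw [natCard_kerPoints_eq_kerRank f L, natCard_kerPoints_eq_kerRank f K]

/-! ## §4 Transitivity of the kernel translations on ALL geometric fibres -/

/-- **Two geometric points of `A` with the same image under a finite étale `f` differ by a RATIONAL kernel
translation** (`K` separably closed, `Ω` any algebraically closed field, `x₁ x₂ : Spec Ω → A` with `x₁ ≫ f = x₂ ≫ f`):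
read `x₁, x₂` as `Ω`-valued points over the common structure map `Spec Ω → Spec K`; then `x₂ · x₁⁻¹ ∈ Ker f(Ω)` is the
scalar extension of some `g ∈ Ker f(K)` (§3), and `x₁ ≫ t_g = g_Ω · x₁ = x₂` (§2) — the hypothesis `htrans` of ★
`isGeometricQuotient_of_etale_of_transitive` for ★ `kerTranslationActionOver f`.
[cite: SGA1, Exp. V Prop. 2.6] [cite: MumfordAV1970, §7 Thm. 4 (p. 72)] -/
theorem kerTranslationActionOver_transitive [IsSepClosed K] [IsFinite (Hom.toSchemeHom f)]
    [Etale (Hom.toSchemeHom f)] (Ω : Type u) [Field Ω] [IsAlgClosed Ω] (x₁ x₂ : Spec (.of Ω) ⟶ A.X.left)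
    (h : x₁ ≫ Hom.toSchemeHom f = x₂ ≫ Hom.toSchemeHom f) :
    ∃ g : Hom.kerPoints (specOver K K) f, x₂ = x₁ ≫ ((kerTranslationActionOver f).aut g).hom := by
  -- the common structure map `Spec Ω → Spec K` makes `Ω` a `K`-algebra
  letI : Algebra K Ω := (Spec.preimage (x₁ ≫ A.X.hom)).hom.toAlgebra
  have hφ : Spec.map (CommRingCat.ofHom (algebraMap K Ω)) = x₁ ≫ A.X.hom := by
    rw [RingHom.algebraMap_toAlgebra, CommRingCat.ofHom_hom, Spec.map_preimage]
  have h₂ : x₂ ≫ A.X.hom = Spec.map (CommRingCat.ofHom (algebraMap K Ω)) := by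
    rw [hφ, ← Over.w f.hom.hom.hom]
    change x₂ ≫ Hom.toSchemeHom f ≫ B.X.hom = x₁ ≫ Hom.toSchemeHom f ≫ B.X.hom
    rw [← Category.assoc, ← h, Category.assoc]
  -- `x₁`, `x₂` as `Ω`-valued points
  let P₁ : A.Points Ω := Over.homMk x₁ hφ.symm
  let P₂ : A.Points Ω := Over.homMk x₂ h₂
  have hP : P₁ ≫ f.hom.hom.hom = P₂ ≫ f.hom.hom.hom := Over.OverMorphism.ext h
  -- the difference lies in `Ker f(Ω)`
  have hmem : P₂ * P₁⁻¹ ∈ Hom.kerPoints (specOver K Ω) f := by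
    rw [Hom.kerPoints, MonoidHom.mem_ker, map_mul, map_inv]
    change (P₂ ≫ _) * (P₁ ≫ _)⁻¹ = 1
    rw [hP, mul_inv_cancel]
  -- and comes from a `K`-rational kernel point
  obtain ⟨g, hg⟩ := (kerPointsComap_toSpecOver_bijective f Ω).2 ⟨P₂ * P₁⁻¹, hmem⟩
  have hg' : toSpecOver (specOver K Ω) ≫ (g : A.Points K) = P₂ * P₁⁻¹ :=
    congrArg (fun z => ((z : Hom.kerPoints (specOver K Ω) f) : A.Points Ω)) hg
  refine ⟨g, ?_⟩
  have hP₂ : P₂ = P₁ ≫ A.translation (g : A.Points K) := by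
    rw [comp_translation_point, hg', inv_mul_cancel_right]
  exact congrArg CommaMorphism.left hP₂

/-! ## §5 The head: an étale isogeny is a geometric quotient by its kernel translations -/

/-- **An ÉTALE isogeny `f : A → B` over a separably closed field is a geometric quotient of `A` by `Ker f(K)`** acting
by translations, in the currency of the descent theorems (`ActionOver.IsGeometricQuotient` for ★
`kerTranslationActionOver f`) — the characteristic-free form of ★ `isGeometricQuotient_kerTranslationActionOver`:
`f` is affine (§1), étale, surjective, and the kernel translations are transitive on all geometric fibres (§4), so
[SGA1] V Prop. 2.6 (★ `isGeometricQuotient_of_etale_of_transitive`) applies.  With §1 `kerTranslationActionOver_free'`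
this is the input of ★ `DescentOfUnitCharacterCount.finite_and_natCard_le_card_of_forall_iso`.
[cite: MumfordAV1970, §7 Thm. p. 66 and Thm. 4 (p. 72)] [cite: SGA1, Exp. V Prop. 2.6, Déf. 2.7] -/
theorem isGeometricQuotient_kerTranslationActionOver_of_etale [IsSepClosed K] (hf : IsIsogeny f)
    [Etale (Hom.toSchemeHom f)] :
    (kerTranslationActionOver f).IsGeometricQuotient (Hom.toSchemeHom f) := by
  haveI : Surjective (Hom.toSchemeHom f) := hf.1
  haveI : IsFinite (Hom.toSchemeHom f) := hf.2
  haveI : Finite (Hom.kerPoints (specOver K K) f) := finite_kerPoints_of_isFinite f K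
  exact (kerTranslationActionOver f).isGeometricQuotient_of_etale_of_transitive
    (fun Ω _ _ x₁ x₂ h => kerTranslationActionOver_transitive f Ω x₁ x₂ h)

end AnyField

/-! ## §6 `#Ker (f ≫ g)(K) = #Ker f(K) · #Ker g(K)` for `f` surjective, `K` algebraically closed -/

section Count

/-- `|ker (g ∘ f)| = |ker f| · |ker g|` for `f` onto (group theory; `Nat.card`, no finiteness) — private re-run of ★
`IsogenyDegree.natCard_ker_comp_of_surjective`. [cite: Lange2023AbelianVarietiesComplex, §1.1.2 Prop. 1.1.13 (b) (PDF p. 22)] -/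
private theorem natCard_ker_comp_of_surjective₂ {G H M : Type*} [Group G] [Group H] [Group M]
    (f : G →* H) (g : H →* M) (hf : Function.Surjective f) :
    Nat.card (g.comp f).ker = Nat.card f.ker * Nat.card g.ker := by
  let φ : (g.comp f).ker →* g.ker :=
    (f.comp (g.comp f).ker.subtype).codRestrict g.ker fun x => by
      have hx := x.2
      rw [MonoidHom.mem_ker, MonoidHom.comp_apply] at hx
      rw [MonoidHom.mem_ker]
      exact hx
  have hφ_apply : ∀ x : (g.comp f).ker, (φ x : H) = f x := fun _ => rfl
  have hφ : Function.Surjective φ := by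
    intro y
    obtain ⟨x, hx⟩ := hf y
    refine ⟨⟨x, ?_⟩, Subtype.ext ?_⟩
    · rw [MonoidHom.mem_ker, MonoidHom.comp_apply, hx]
      exact y.2
    · rw [hφ_apply]
      exact hx
  have hker : Nat.card φ.ker = Nat.card f.ker := by
    refine Nat.card_congr
      { toFun := fun x => ⟨(x.1 : G), ?_⟩
        invFun := fun x => ⟨⟨x.1, ?_⟩, ?_⟩
        left_inv := fun x => rfl
        right_inv := fun x => rfl }
    · have hx := x.2
      rw [MonoidHom.mem_ker] at hx
      rw [MonoidHom.mem_ker, ← hφ_apply, hx, Subgroup.coe_one]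
    · have hx := x.2
      rw [MonoidHom.mem_ker] at hx
      rw [MonoidHom.mem_ker, MonoidHom.comp_apply, hx, map_one]
    · have hx := x.2
      rw [MonoidHom.mem_ker] at hx
      rw [MonoidHom.mem_ker]
      exact Subtype.ext hx
  rw [Subgroup.card_eq_card_quotient_mul_card_subgroup φ.ker, hker,
    Nat.card_congr (QuotientGroup.quotientKerEquivOfSurjective φ hφ).toEquiv, mul_comm]

variable {K : Type u} [Field K] [IsAlgClosed K] {A B C : AbelianVariety K}

/-- **`#Ker (f ≫ g)(K) = #Ker f(K) · #Ker g(K)` for `f` surjective over an algebraically closed field `K`**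
([Lange2023AbelianVarietiesComplex] Prop. 1.1.13 (b) «`deg (g ∘ f) = deg f · deg g`» on rational points; `Nat.card`,
so both sides vanish when a kernel is infinite): the exact sequence `1 → Ker f(K) → Ker (f ≫ g)(K) → Ker g(K) → 1`,
`f(K)` being onto (★ `AlgPoints.map_surjective_of_surjective_of_isAlgClosed'`).  The ★ complex
`natCard_kerPoints_comp`, characteristic-free. [cite: Lange2023AbelianVarietiesComplex, §1.1.2 Prop. 1.1.13 (b) (PDF p. 22)]
[cite: MumfordAV1970, §7 Thm. 4 (p. 72)] -/
theorem natCard_kerPoints_comp_of_isAlgClosed (f : A ⟶ B) (g : B ⟶ C) [Surjective (Hom.toSchemeHom f)] :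
    Nat.card (Hom.kerPoints (specOver K K) (f ≫ g)) =
      Nat.card (Hom.kerPoints (specOver K K) f) * Nat.card (Hom.kerPoints (specOver K K) g) := by
  have hsurj : Function.Surjective (IsMonHom.monoidHom f.hom.hom.hom (specOver K K)) := by
    haveI : Surjective f.hom.hom.hom.left := ‹Surjective (Hom.toSchemeHom f)›
    exact AlgPoints.map_surjective_of_surjective_of_isAlgClosed' f.hom.hom.hom
  have hcomp : IsMonHom.monoidHom (f ≫ g).hom.hom.hom (specOver K K) =
      (IsMonHom.monoidHom g.hom.hom.hom (specOver K K)).comp (IsMonHom.monoidHom f.hom.hom.hom (specOver K K)) :=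
    MonoidHom.ext fun P => by
      simp only [MonoidHom.comp_apply, IsMonHom.monoidHom_apply]
      exact (Category.assoc _ _ _).symm
  change Nat.card (IsMonHom.monoidHom (f ≫ g).hom.hom.hom (specOver K K)).ker = _
  rw [hcomp]
  exact natCard_ker_comp_of_surjective₂ _ _ hsurj

/-- Prop. 1.1.13 (b) for an isogeny `f`, over an algebraically closed field.
[cite: Lange2023AbelianVarietiesComplex, §1.1.2 Prop. 1.1.13 (b) (PDF p. 22)] -/
theorem IsIsogeny.natCard_kerPoints_comp_of_isAlgClosed {f : A ⟶ B} (hf : IsIsogeny f) (g : B ⟶ C) :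
    Nat.card (Hom.kerPoints (specOver K K) (f ≫ g)) =
      Nat.card (Hom.kerPoints (specOver K K) f) * Nat.card (Hom.kerPoints (specOver K K) g) := by
  haveI : Surjective (Hom.toSchemeHom f) := hf.1
  exact AbelianVariety.natCard_kerPoints_comp_of_isAlgClosed f g

end Count

end AbelianVariety

end Literature.AlgebraicGeometry.Motives

end
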